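import Summits.HodgeConjecture.HodgeConjecture.Theses.NodalThetaWeil
import Literature.AlgebraicGeometry.HodgeTheory.NodalDivisor
import Literature.AlgebraicGeometry.HodgeTheory.WeilClassesHodgeType
import Literature.AlgebraicGeometry.Motives.CartierDivisorOfIdealSheaf
import Literature.AlgebraicGeometry.HodgeTheory.WeilClassesSixfoldsProofs
import Literature.AlgebraicGeometry.HodgeTheory.ArapuraSurfaceFibredFourfoldsProofs
import Literature.AlgebraicGeometry.HodgeTheory.SupportedClassesRationalProofs
import Literature.AlgebraicGeometry.HodgeTheory.ClassesSupportedOn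
import Literature.AlgebraicGeometry.HodgeTheory.GysinFormalismPushforward
import Literature.AlgebraicGeometry.Resolution.AlterationsInduction
import Literature.AlgebraicGeometry.Motives.MumfordTateInvariantsSubHodge
import HarnessLib

/-!
# Crux `NodalThetaSupport` (stmt-HodgeConjecture-7744), line `birth` — stub A
# `stub_weilPlane_coniveau_rigidity`: K-RIGIDITY OF CONIVEAU ON THE WEIL PLANE

Route `HodgeConjecture/NodalThetaWeil`; registered skeleton `Cruxes/NodalThetaSupport/Lines/birth.lean`
(`NodalThetaSupport_of`: STUB A K-rigidity of coniveau on the Weil plane (this file) → STUB B a Weil-visible class on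
a nodal theta divisor of every balanced Weil sixfold (THE HEART, open) → the crux BY NAME). After this file the crux
is, in the kernel, exactly STUB B (§6).

**Theorem** (`stub_weilPlane_coniveau_rigidity`, the registered signature verbatim). Let `(A, φ)` be a complex abelian
sixfold with `φ ≫ φ = -d·𝟙`, `d ≥ 1`, `ι : D ↪ A` a closed immersion whose ideal is an effective Cartier divisor, and
`s ∈ H⁶(A(ℂ); ℂ)` a class supported on `D` (it dies on `(A ∖ D)(ℂ)`) which is WEIL-VISIBLE: for some test isogeny
`ψ = x·𝟙 + y·φ`, `x > 0`, and some polynomial `p`, `t := p(ψ^*) s` is a non-zero class of the Weil plane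
`W = E₊ ⊔ E₋ = weilClassesOf A φ 3 d`. Then `W ≤ N¹H⁶(A(ℂ); ℂ) = supportedClasses A.X 6 1`.

Proof. §3: the support of `ι` is closed (closed immersion) and proper (a local equation of an effective Cartier
divisor is regular, hence a unit at the generic point: `genericPoint_notMem_support`, `Scheme.Hom.support_ker`), so
its points have codimension `≥ 1` (`one_le_coheight_of_mem_of_isClosed`) and `s ∈ N¹`
(`classesSupportedOn_le_supportedClasses`). §2: `N¹` is stable under the pull-backs `(x·𝟙 + y·φ)^*`,
`(x, y) ≠ (0, 0)` — isogenies (`isIsogeny_nsmul_id_add_nsmul`), and surjective pull-backs preserve coniveau `≥ 1`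
(`map_mem_supportedClasses_one_of_surjective`) — hence under `p(ψ^*)`
(`HodgeStructure.aeval_apply_mem_of_forall_mem`): `t ∈ N¹ ∩ W`, `t ≠ 0`. The Weil
characters being separated at an isogeny (`exists_ne_weilCharacter`), the components `t₊ ∈ E₊`, `t₋ ∈ E₋` of `t` lie
in `N¹` (`mem_of_sum_eigenvectors_mem`); one is non-zero and spans its line (`dim E± = 1`, from
`H•(A(ℂ)) = ⋀• H¹`, `b₁ = 12`: `abelianVarietyCohomologyExteriorH1_holds`, `weilClassesPlus_le_span_singleton`); its
complex conjugate is a non-zero class on the other line, again in `N¹` (§1: `N¹` is the span of its rational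
classes, `supportedClasses_eq_span_isRationalClass`, so conjugation preserves it). Hence `E₊ ⊔ E₋ ≤ N¹`. This is
the tree's `weilClassesOf_le_algebraicClasses_of_exists_ne_zero` (van Geemen, proof of Thm. 6.12) with
`algebraicClasses` replaced by `N¹`.

§4 states the stub in the registered spelling (file-local notation `IsWeilVisible` for the skeleton's predicate;
display only); §5 gives the crux BY NAME from STUB B (file-local notation `IsNodalThetaMember`).

HONEST STATUS. Nothing here is a case of the Hodge conjecture; STUB B (the route's thesis: a Weil-visible class on
a nodal theta divisor) remains the crux. No definition, no named fact, no sorry.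
References: [vanGeemen1994HodgeAV] 4.9–4.11, Lemma 5.2, proof of Thm. 6.12; [GrothendieckTopology1969] §1 and
pp. 299–300; [GortzWedhorn2023] Prop. 27.187; [GortzWedhorn2020] (13.19); [Thomas2005Nodes] Thm. 1.
-/

noncomputable section

set_option linter.dupNamespace false

open CategoryTheory AlgebraicGeometry
open Literature.AlgebraicGeometry.Motives Literature.AlgebraicGeometry.HodgeTheory
  Literature.AlgebraicGeometry.Resolution Literature.AlgebraicTopology.SingularHomology

namespace Summit.HodgeConjecture.HodgeConjecture.Theorems.NodalThetaSupport

/-! ## §1 `Nˢ Hᵏ` is stable under complex conjugation -/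

/-- **Complex conjugation preserves `Nˢ Hᵏ(X(ℂ); ℂ)`** for `X` smooth projective: `Nˢ Hᵏ` is the
complex span of its rational classes (`supportedClasses_eq_span_isRationalClass`, Grothendieck 1969
pp. 299–300) and conjugation fixes rational classes. (The case `k = 2p`, `s = p` is the tree's
`conjClass_mem_algebraicClasses`.) [cite: GrothendieckTopology1969, pp. 299–300] [cite: VoisinHodgeI2002, Cor. 6.12] -/
theorem conjClass_mem_supportedClasses {m : ℕ} {X : SchemeOver ℂ} (hX : IsSmoothProjective m X)
    {k s : ℕ} {c : complexBetti X k} (hc : c ∈ supportedClasses X k s) :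
    conjClass (ComplexPoints X) k c ∈ supportedClasses X k s := by
  have hspan := supportedClasses_eq_span_isRationalClass hX k s
  rw [hspan] at hc ⊢
  have hrange : {c : complexBetti X k | IsRationalClass c ∧ c ∈ supportedClasses X k s} =
      Set.range (fun c : {c : complexBetti X k //
        IsRationalClass c ∧ c ∈ supportedClasses X k s} => (c : complexBetti X k)) := by
    rw [Subtype.range_coe_subtype]
  rw [hrange] at hc ⊢
  exact conjClass_mem_span_of_isRationalClass (fun c => c.2.1) hc

/-! ## §2 `N¹` and the Weil eigen-lines of an abelian variety with `φ² = -d` -/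

section Weil

variable {A : AbelianVariety ℂ}

/-- **The isogenies `x·𝟙 + y·φ`, `(x, y) ≠ (0, 0)`, preserve `N¹ Hⁱ(A(ℂ); ℂ)` by pull-back**: they
are surjective (`isIsogeny_nsmul_id_add_nsmul`), and pull-back along a surjective morphism of smooth
projective varieties preserves coniveau `≥ 1` (`map_mem_supportedClasses_one_of_surjective`).
[cite: GortzWedhorn2023, Prop. 27.187] [cite: GrothendieckTopology1969, §1] -/
theorem map_nsmul_id_add_nsmul_mem_supportedClasses_one {m d : ℕ} (hA : IsSmoothProjective m A.X)
    (hd : 0 < d) {φ : A ⟶ A} (hφ : φ ≫ φ = -(d • 𝟙 A)) (x y : ℕ) (hxy : (x, y) ≠ (0, 0)) {i : ℕ}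
    {c : complexBetti A.X i} (hc : c ∈ supportedClasses A.X i 1) :
    complexBetti.map (x • 𝟙 A + y • φ).hom.hom.hom i c ∈ supportedClasses A.X i 1 :=
  map_mem_supportedClasses_one_of_surjective hA hA _
    (isIsogeny_nsmul_id_add_nsmul hd hφ hxy).1.surj hc

/-- **Eigencomponents of a class of coniveau `≥ 1` have coniveau `≥ 1`**: if `v_i` (`i ∈ s`) are
joint eigenclasses of the `(x·𝟙 + y·φ)^*` for characters pairwise separated away from the origin and
`Σ v_i ∈ N¹`, then every `v_i ∈ N¹` (`mem_of_sum_eigenvectors_mem` with `S = N¹`, stable under the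
isogeny pull-backs). The `N¹`-analogue of `mem_algebraicClasses_of_sum_mem_pullbackEigenclasses`.
[cite: vanGeemen1994HodgeAV, proof of Thm. 6.12] -/
theorem mem_supportedClasses_one_of_sum_mem_pullbackEigenclasses {m n d : ℕ}
    (hA : IsSmoothProjective m A.X) (hd : 0 < d) {φ : A ⟶ A} (hφ : φ ≫ φ = -(d • 𝟙 A))
    {ι : Type*} (s : Finset ι) (χ : ι → ℕ → ℕ → ℂ)
    (hχ : ∀ i ∈ s, ∀ j ∈ s, i ≠ j → ∃ x y : ℕ, (x, y) ≠ (0, 0) ∧ χ i x y ≠ χ j x y)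
    (v : ι → complexBetti A.X (2 * n))
    (hv : ∀ i ∈ s, v i ∈ pullbackEigenclasses A φ (2 * n) (χ i))
    (hsum : ∑ i ∈ s, v i ∈ supportedClasses A.X (2 * n) 1) :
    ∀ i ∈ s, v i ∈ supportedClasses A.X (2 * n) 1 := by
  refine mem_of_sum_eigenvectors_mem (P := {q : ℕ × ℕ // q ≠ (0, 0)})
    (fun q => (complexBetti.map (q.1.1 • 𝟙 A + q.1.2 • φ).hom.hom.hom (2 * n)).hom)
    (supportedClasses A.X (2 * n) 1) (fun q w hw => ?_) (fun i q => χ i q.1.1 q.1.2) s ?_ v ?_ hsum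
  · exact map_nsmul_id_add_nsmul_mem_supportedClasses_one hA hd hφ q.1.1 q.1.2 q.2 hw
  · intro i hi j hj hij
    obtain ⟨x, y, hxy, h⟩ := hχ i hi j hj hij
    exact ⟨⟨(x, y), hxy⟩, h⟩
  · intro i hi q
    exact (mem_pullbackEigenclasses_iff.mp (hv i hi)) q.1.1 q.1.2

/-- **The `E₊`- and `E₋`-components of a class of the Weil plane lying in `N¹` lie in `N¹`**
(`n, d ≥ 1`; the two Weil characters are separated at an isogeny `x·𝟙 + φ`,
`exists_ne_weilCharacter`). The `N¹`-analogue of `mem_algebraicClasses_of_add_mem_weilClasses`.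
[cite: vanGeemen1994HodgeAV, proof of Thm. 6.12] -/
theorem mem_supportedClasses_one_of_add_mem_weilClasses {m n d : ℕ}
    (hA : IsSmoothProjective m A.X) (hn : 0 < n) (hd : 0 < d) {φ : A ⟶ A}
    (hφ : φ ≫ φ = -(d • 𝟙 A)) {c₁ c₂ : complexBetti A.X (2 * n)}
    (h₁ : c₁ ∈ weilClassesPlus A φ n d) (h₂ : c₂ ∈ weilClassesMinus A φ n d)
    (hN : c₁ + c₂ ∈ supportedClasses A.X (2 * n) 1) :
    c₁ ∈ supportedClasses A.X (2 * n) 1 ∧ c₂ ∈ supportedClasses A.X (2 * n) 1 := by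
  let χ : Bool → ℕ → ℕ → ℂ := fun b x y =>
    if b then ((x : ℂ) + (y : ℂ) * Complex.I * (Real.sqrt d : ℂ)) ^ (2 * n)
    else ((x : ℂ) - (y : ℂ) * Complex.I * (Real.sqrt d : ℂ)) ^ (2 * n)
  let v : Bool → complexBetti A.X (2 * n) := fun b => if b then c₁ else c₂
  have hv : ∀ b ∈ (Finset.univ : Finset Bool), v b ∈ pullbackEigenclasses A φ (2 * n) (χ b) := by
    rintro (_ | _) -
    · exact h₂
    · exact h₁
  have hχ : ∀ i ∈ (Finset.univ : Finset Bool), ∀ j ∈ (Finset.univ : Finset Bool), i ≠ j →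
      ∃ x y : ℕ, (x, y) ≠ (0, 0) ∧ χ i x y ≠ χ j x y := by
    obtain ⟨x, y, hxy, hne⟩ := exists_ne_weilCharacter hn hd
    rintro (_ | _) - (_ | _) - hij
    · exact absurd rfl hij
    · exact ⟨x, y, hxy, hne.symm⟩
    · exact ⟨x, y, hxy, hne⟩
    · exact absurd rfl hij
  have hsum : ∑ b ∈ (Finset.univ : Finset Bool), v b ∈ supportedClasses A.X (2 * n) 1 := by
    simpa [v] using hN
  have key := mem_supportedClasses_one_of_sum_mem_pullbackEigenclasses hA hd hφ Finset.univ χ hχ v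
    hv hsum
  exact ⟨key true (Finset.mem_univ _), key false (Finset.mem_univ _)⟩

/-- **One non-zero class of the Weil plane of coniveau `≥ 1` puts the whole Weil plane in `N¹`**,
granted `H•(A(ℂ); ℂ) = ⋀• H¹` and `b₁ = 4n`: both components of the class lie in `N¹`
(`mem_supportedClasses_one_of_add_mem_weilClasses`), one of them is non-zero and spans its line
(`dim E± = 1`), and its complex conjugate is a non-zero class of `N¹` on the other line
(`conjClass_mem_supportedClasses`). The `N¹`-analogue of
`weilClassesOf_le_algebraicClasses_of_exists_ne_zero`. [cite: vanGeemen1994HodgeAV, proof of Thm. 6.12 and Lemma 5.2] -/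
theorem weilClassesOf_le_supportedClasses_one_of_exists_ne_zero {n d : ℕ}
    (hA : IsSmoothProjective (2 * n) A.X) (hn : 0 < n) (hd : 0 < d)
    {φ : A ⟶ A} (hφ : φ ≫ φ = -(d • 𝟙 A))
    (hΛ : HasExteriorCohomologyH1 ℂ (ComplexPoints A.X))
    (hb₁ : Module.finrank ℂ (complexBetti A.X 1) = 2 * (2 * n))
    (hex : ∃ c ∈ weilClassesOf A φ n d, c ∈ supportedClasses A.X (2 * n) 1 ∧ c ≠ 0) :
    weilClassesOf A φ n d ≤ supportedClasses A.X (2 * n) 1 := by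
  obtain ⟨c, hcW, hcN, hc0⟩ := hex
  obtain ⟨c₁, h₁, c₂, h₂, rfl⟩ := Submodule.mem_sup.mp hcW
  obtain ⟨hN₁, hN₂⟩ := mem_supportedClasses_one_of_add_mem_weilClasses hA hn hd hφ h₁ h₂ hcN
  -- a non-zero class of `N¹` on EACH Weil line
  have hplus : ∃ e ∈ weilClassesPlus A φ n d, e ∈ supportedClasses A.X (2 * n) 1 ∧ e ≠ 0 := by
    by_cases h10 : c₁ = 0
    · have h20 : c₂ ≠ 0 := by rintro rfl; exact hc0 (by rw [h10, add_zero])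
      exact ⟨_, conjClass_mem_weilClassesPlus h₂, conjClass_mem_supportedClasses hA hN₂,
        conjClass_ne_zero h20⟩
    · exact ⟨c₁, h₁, hN₁, h10⟩
  obtain ⟨e₁, he₁, hNe₁, he₁0⟩ := hplus
  have hminus : ∃ e ∈ weilClassesMinus A φ n d, e ∈ supportedClasses A.X (2 * n) 1 ∧ e ≠ 0 :=
    ⟨_, conjClass_mem_weilClassesMinus he₁, conjClass_mem_supportedClasses hA hNe₁,
      conjClass_ne_zero he₁0⟩
  obtain ⟨e₂, he₂, hNe₂, he₂0⟩ := hminus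
  exact sup_le
    ((weilClassesPlus_le_span_singleton hΛ hb₁ hd hφ he₁ he₁0).trans
      ((Submodule.span_singleton_le_iff_mem _ _).mpr hNe₁))
    ((weilClassesMinus_le_span_singleton hΛ hb₁ hd hφ he₂ he₂0).trans
      ((Submodule.span_singleton_le_iff_mem _ _).mpr hNe₂))

end Weil

/-! ## §3 Classes supported on an effective Cartier divisor have coniveau `≥ 1` -/

/-- **The support of a closed subscheme which is an effective Cartier divisor on a smooth
projective variety is a proper Zariski-closed subset**: a local equation is a regular element, hence
invertible at the generic point (`genericPoint_notMem_support`), and the support of the kernel ideal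
of a closed immersion is its (closed) image. [cite: GortzWedhorn2020, (13.19)] -/
theorem support_ne_univ_of_isEffectiveCartier {X D : SchemeOver ℂ} [IsIntegral X.left]
    (ι : D ⟶ X) [IsClosedImmersion ι.left] (hI : IsEffectiveCartier ι.left.ker) :
    support ι ≠ Set.univ := by
  intro h
  have hη := DeJong1996.NormalProjectivePair.genericPoint_notMem_support (X := X.left) hI
  apply hη
  have hsub : support ι ⊆ (ι.left.ker.support : Set X.left) := by
    rw [Scheme.Hom.support_ker]
    exact subset_closure
  exact hsub (h.symm ▸ Set.mem_univ _)

/-- **Classes supported on an effective Cartier divisor `ι : D ↪ X` (`X` smooth projective) lie in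
`N¹ Hⁱ(X(ℂ); ℂ)`**: `support ι` is closed (closed immersion) and proper, so all its points have
codimension `≥ 1` (`one_le_coheight_of_mem_of_isClosed`). [cite: GrothendieckTopology1969, §1] -/
theorem classesSupportedOn_support_le_supportedClasses_one {m : ℕ} {X D : SchemeOver ℂ}
    (hX : IsSmoothProjective m X) [IsIntegral X.left] (ι : D ⟶ X) [IsClosedImmersion ι.left]
    (hI : IsEffectiveCartier ι.left.ker) (i : ℕ) :
    classesSupportedOn X (support ι) i ≤ supportedClasses X i 1 := by
  have hcl : IsClosed (support ι) := ι.left.isClosedEmbedding.isClosed_range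
  exact classesSupportedOn_le_supportedClasses hcl
    (fun z hz ↦ one_le_coheight_of_mem_of_isClosed hX hcl
      (support_ne_univ_of_isEffectiveCartier ι hI) hz) i

/-! ## §4 The stub, in the registered spelling -/

section Stub

/-- `IsWeilVisible A φ d s` — the skeleton's Weil-visibility predicate (display only; nothing is
defined): some polynomial in one test pull-back `(x·𝟙 + y·φ)^*`, `x > 0`, moves `s` to a non-zero
class of the Weil plane. -/
local notation3 "IsWeilVisible " A:max φ:max d:max s:max =>
  (∃ (x y : ℕ) (p : Polynomial ℂ), 0 < x ∧
    Polynomial.aeval (complexBetti.map (x • 𝟙 A + y • φ).hom.hom.hom (2 * 3)).hom p s ∈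
        weilClassesOf A φ 3 d ∧
      Polynomial.aeval (complexBetti.map (x • 𝟙 A + y • φ).hom.hom.hom (2 * 3)).hom p s ≠ 0)

/-- **Stub `stub_weilPlane_coniveau_rigidity` of crux `NodalThetaSupport` (registered signature,
verbatim in the skeleton's spelling): K-rigidity of coniveau on the Weil plane.** On an abelian
sixfold `(A, φ ≫ φ = -d·𝟙)`, `d ≥ 1`, if a class `s` supported on an effective Cartier divisor
`ι : D ↪ A` is Weil-visible, then the whole Weil plane `E₊ ⊔ E₋` lies in `N¹H⁶(A(ℂ); ℂ)`:
`s ∈ N¹` (§3); `N¹` is stable under the isogeny pull-back `(x·𝟙 + y·φ)^*`, `x > 0`, hence under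
`p((x·𝟙 + y·φ)^*)` (§2), so the visible class `t = p(ψ^*) s` is a non-zero class of the Weil plane in
`N¹`, and §2 (`weilClassesOf_le_supportedClasses_one_of_exists_ne_zero`, with
`H•(A(ℂ)) = ⋀• H¹`, `b₁ = 12` from `abelianVarietyCohomologyExteriorH1_holds`) concludes.
[cite: vanGeemen1994HodgeAV, 4.9–4.11 and Lemma 5.2] [cite: GrothendieckTopology1969, §1]
[cite: GortzWedhorn2023, Prop. 27.187] -/
theorem stub_weilPlane_coniveau_rigidity :
    ∀ (d : ℕ), 0 < d → ∀ (A : AbelianVariety ℂ) (φ : A ⟶ A), A.dim = 2 * 3 →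
      IsSmoothProjective (2 * 3) A.X → φ ≫ φ = -(d • 𝟙 A) →
      ∀ ⦃D : SchemeOver ℂ⦄ (ι : D ⟶ A.X), IsClosedImmersion ι.left →
        IsEffectiveCartier ι.left.ker →
        ∀ s ∈ classesSupportedOn A.X (support ι) (2 * 3), IsWeilVisible A φ d s →
          weilClassesOf A φ 3 d ≤ supportedClasses A.X (2 * 3) 1 := by
  intro d hd A φ hdim hsp hφ D ι hι hI s hs hvis
  obtain ⟨x, y, p, hx, htW, ht0⟩ := hvis
  obtain ⟨-, hb₁, hΛ⟩ := abelianVarietyCohomologyExteriorH1_holds A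
  rw [hdim] at hb₁
  haveI := hι
  haveI : IsIntegral A.X.left := SchemeOver.isIntegral_left A.X
  -- `s ∈ N¹`
  have hsN : s ∈ supportedClasses A.X (2 * 3) 1 :=
    classesSupportedOn_support_le_supportedClasses_one hsp ι hI _ hs
  -- `t = p(ψ^*) s ∈ N¹`
  have hxy : (x, y) ≠ (0, 0) := fun h ↦ hx.ne' (congrArg Prod.fst h)
  have htN := HodgeStructure.aeval_apply_mem_of_forall_mem
    (complexBetti.map (x • 𝟙 A + y • φ).hom.hom.hom (2 * 3)).hom (supportedClasses A.X (2 * 3) 1)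
    (fun v hv ↦ map_nsmul_id_add_nsmul_mem_supportedClasses_one hsp hd hφ x y hxy hv) p hsN
  exact weilClassesOf_le_supportedClasses_one_of_exists_ne_zero hsp (by norm_num) hd hφ hΛ hb₁
    ⟨_, htW, htN, ht0⟩

/-! ## §5 The crux from STUB B alone -/

/-- `IsNodalThetaMember A Θ k ι` — the skeleton's "`ι` is an `m`-nodal (`m ≥ 1`) member of `|kΘ|`"
(display only; nothing is defined). -/
local notation3 "IsNodalThetaMember " A:max Θ:max k:max ι:max =>
  (∃ m : ℕ, 1 ≤ m ∧ IsNodalDivisor 5 m ι ∧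
    ∃ hI : IsEffectiveCartier (ι).left.ker,
      (CartierDivisor.ofIsEffectiveCartier (ι).left.ker hI).LinEquiv (k • Θ))

/-- **The crux `NodalThetaSupport` BY NAME from STUB B alone** (the skeleton's composition
`NodalThetaSupport_of` with STUB A = `stub_weilPlane_coniveau_rigidity` (this file) discharged): for a
rational `(3,3)` Weil class `c ≠ 0`, `(A, φ)` is balanced (Deligne–Milne 4.4 "only if",
`finrank_eq_of_mem_weilClassesOf`), STUB B supplies a nodal theta member with a Weil-visible supported
class, and STUB A puts the Weil plane, hence `c`, in `N¹H⁶`. The hypothesis is the registered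
signature of `stub_nodalThetaMember_weilVisible`, verbatim in the skeleton's spelling.
[cite: Thomas2005Nodes, Thm. 1] [cite: Deligne1982HodgeCycles, Prop. 4.4] -/
theorem nodalThetaSupport_of_nodalThetaMember_weilVisible
    (hB : ∀ (d : ℕ), 0 < d → ∀ (A : AbelianVariety ℂ) (φ : A ⟶ A), A.dim = 2 * 3 →
      ∀ hsp : IsSmoothProjective (2 * 3) A.X, φ ≫ φ = -(d • 𝟙 A) →
      Module.finrank ℂ ↥(Module.End.eigenspace (complexBetti.map φ.hom.hom.hom 1).hom
            (Complex.I * (Real.sqrt d : ℂ)) ⊓ hodgeOneZero hsp) = 3 →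
      ∃ (Θ : CartierDivisor A.X.left) (k : ℕ) (D : SchemeOver ℂ) (ι : D ⟶ A.X),
        Θ.IsAmple ∧ 2 ≤ k ∧ IsNodalThetaMember A Θ k ι ∧
        ∃ s ∈ classesSupportedOn A.X (support ι) (2 * 3), IsWeilVisible A φ d s) :
    Summit.HodgeConjecture.HodgeConjecture.Theses.NodalThetaWeil.NodalThetaSupport := by
  intro d hd A φ hdim hsp hφ c _hr hh hw
  have hcW : c ∈ weilClassesOf A φ 3 d := mem_weilClassesOf_iff.mpr hw
  by_cases hc : c = 0
  · rw [hc]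
    exact Submodule.zero_mem _
  have hbal := finrank_eq_of_mem_weilClassesOf (m := 3) (by norm_num) hdim hd hφ hcW hc hh
  obtain ⟨Θ, k, D, ι, -, -, ⟨m, -, hnod, hI, -⟩, s, hs, hvis⟩ := hB d hd A φ hdim hsp hφ hbal
  exact stub_weilPlane_coniveau_rigidity d hd A φ hdim hsp hφ ι hnod.isClosedImmersion hI s hs hvis hcW

end Stub

end Summit.HodgeConjecture.HodgeConjecture.Theorems.NodalThetaSupport

end
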